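import Summits.CriticalPhenomena.PercolationContinuityZ3.Theorems.SahiMasterFamilyTerminalTightAll
import Summits.CriticalPhenomena.PercolationContinuityZ3.Theorems.SahiMasterFamilyPureFailures

/-!
# The local-to-global step from (α): glued annihilator points failing two pure members ⟹ LG_k whenever `|P| = 2` or `|N| = 2`; hence LG_5

Unit `prim-master-conj` (crux anchor stmt-CriticalPhenomena-4575), gen 12; memo HOME/prim-master-conj/TIGHTNESS-IV.md §2.
Setting of `LocalToGlobal` (glued frame field `gframe`, pure members `P` = empty glued annihilator, non-pure members `N`).  The structure theory
says that in a STRUCTURED family every annihilator point fails two pure members (`two_le_card_pureFail`, file `SahiMasterFamilyPureFailures`).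
The glued analogue

  **(α)** every configuration of the glued annihilator `gann y` lies outside at least two PURE members

is what the local-to-global step needs, and this file proves that it suffices whenever `|P| = 2` or `|N| = 2` — in particular at order five:
* `gframe_eq_hull_of_cover` — (β) from (α): the glued frame of `y` is the hull of `U y` over any set of coordinates missing the glued block of `y`
  and covering the supports of the pure members that fail at the annihilator points;
* `structured_insert_pures_of_alpha` — (α) at one non-pure `v` ⟹ `P + v` is structured (so `|N| = 2` gives a structured deletion);
* `goodChain_append_pair_of_alpha` — `|P| = 2`, (α) at the listed non-pure members ⟹ `(pure pair, then those members in ANY order)` is a good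
  chain with the glued frames (induction on the length; the robustness sets are handled by the induction hypothesis on sub-lists);
* **`localToGlobal_of_alpha`** — the hypotheses of `LocalToGlobal`, (α) at every member, and `|P| = 2 ∨ |N| = 2` are contradictory;
* `AlphaGlued n` — (α) for `(n+4)`-families under the hypotheses of `LocalToGlobal n` (a named `Prop`, proved in the next file);
* **`localToGlobal_one_of_alphaGlued : AlphaGlued 1 → LocalToGlobal 1`**, **`masterFamilyIdentEqIff_five_of_alphaGlued`**.
A reduction; `AlphaGlued 1` is a hypothesis here, never used as a fact.  Pure combinatorics; axioms standard. [this work]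
-/

noncomputable section

open scoped Classical

namespace Summit.CriticalPhenomena.PercolationContinuityZ3.Theorems

namespace GluedFrames

open Finset Function
open Literature.Probability.LatticeModels.Kahn2022 (Affects)

variable {ι : Type*} [Fintype ι] {κ : Type*} (U : κ → Set (Set ι)) (W : Finset κ)

/-! ### (β) from (α): the glued frame is a hull -/

/-- **(β) from (α).**  If `S` misses the essential support of the glued frame of `y` and every configuration of the glued annihilator of `y` lies
outside some non-empty member whose essential support is inside `S`, then `gframe y = hull S (U y)`. [this work] -/
theorem gframe_eq_hull_of_cover (hU : ∀ k, IsUpperSet (U k)) (hne : ∀ k, (U k).Nonempty) {y : κ} {S : Set ι}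
    (hS : Disjoint S ↑(esupp (gframe U W y))) (hcov : ∀ χ ∈ gann U W y, ∃ p, χ ∉ U p ∧ ↑(esupp (U p)) ⊆ S) :
    gframe U W y = hull S (U y) := by
  ext ω
  rw [mem_hull]
  constructor
  · intro hω
    by_contra hωU
    have hA : ω ∪ S ∈ gframe U W y := isUpperSet_gframe U W hU y Set.subset_union_left hω
    obtain ⟨p, hp, hpS⟩ := hcov _ ⟨hA, hωU⟩
    exact hp (TightFrames.mem_of_esupp_subset (hU p) (hne p) fun x hx => Or.inr (hpS hx))
  · intro hω
    exact mem_of_union_mem_of_disjoint_esupp (isUpperSet_gframe U W hU y) hS (subset_gframe U W hU y hω)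

/-- A hull over coordinates missing the glued block of `y` lies inside the glued frame; so its annihilator points are glued annihilator points.
[this work] -/
theorem hull_subset_gframe (hU : ∀ k, IsUpperSet (U k)) {y : κ} {S : Set ι} (hS : Disjoint S ↑(esupp (gframe U W y))) :
    hull S (U y) ⊆ gframe U W y := fun _ hω =>
  mem_of_union_mem_of_disjoint_esupp (isUpperSet_gframe U W hU y) hS (subset_gframe U W hU y (mem_hull.1 hω))

/-- The union of the essential supports of the PURE members misses the glued block of a non-pure member (support-disjoint glued frames).
[this work] -/
theorem disjoint_pureUnion_esupp_gframe (hU : ∀ k, IsUpperSet (U k))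
    (hd : ∀ x ∈ W, ∀ x' ∈ W, x ≠ x' → Disjoint (esupp (gframe U W x)) (esupp (gframe U W x'))) {y : κ} (hy : y ∈ W)
    (hyN : gann U W y ≠ ∅) :
    Disjoint (⋃ p ∈ W.filter (fun p => gann U W p = ∅), (↑(esupp (U p)) : Set ι)) ↑(esupp (gframe U W y)) := by
  rw [Set.disjoint_iUnion₂_left]
  intro p hp
  rw [mem_filter] at hp
  have hpy : p ≠ y := fun h => hyN (h ▸ hp.2)
  have := hd p hp.1 y hy hpy
  rw [(gann_eq_empty_iff U W hU p).1 hp.2] at this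
  exact disjoint_coe.2 this

/-! ### `|N| = 2`: one non-pure member over the pure members -/

/-- **(α) at one non-pure member `v` makes `P + v` structured** (`P` = the pure members). [this work] -/
theorem structured_insert_pures_of_alpha (hU : ∀ k, IsUpperSet (U k))
    (hd : ∀ x ∈ W, ∀ x' ∈ W, x ≠ x' → Disjoint (esupp (gframe U W x)) (esupp (gframe U W x'))) {v : κ} (hv : v ∈ W)
    (hvN : gann U W v ≠ ∅)
    (hα : ∀ χ ∈ gann U W v, 2 ≤ ((W.filter fun p => gann U W p = ∅).filter fun p => χ ∉ U p).card) :
    Structured U (insert v (W.filter fun p => gann U W p = ∅)) := by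
  set P := W.filter fun p => gann U W p = ∅ with hPdef
  have hvP : v ∉ P := fun h => hvN (mem_filter.1 h).2
  have hdP : ∀ w ∈ P, ∀ w' ∈ P, w ≠ w' → Disjoint (esupp (U w)) (esupp (U w')) := by
    intro w hw w' hw' hww'
    rw [hPdef, mem_filter] at hw hw'
    have := hd w hw.1 w' hw'.1 hww'
    rwa [(gann_eq_empty_iff U W hU w).1 hw.2, (gann_eq_empty_iff U W hU w').1 hw'.2] at this
  refine structured_insert_of_pairwise_disjoint U hU hvP hdP fun φ hφ hφU => ?_
  have hφg : φ ∈ gframe U W v := hull_subset_gframe U W hU (disjoint_pureUnion_esupp_gframe U W hU hd hv hvN) hφ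
  exact hα φ ⟨hφg, hφU⟩

/-! ### `|P| = 2`: the pure pair, then the non-pure members in any order -/

/-- A finite set of size `≥ 2` filtered from a set inside `{a, b}` witnesses both `a` and `b`. [folklore] -/
theorem and_of_two_le_card_filter {S : Finset κ} {q : κ → Prop} [DecidablePred q] {a b : κ} (hS : S ⊆ {a, b})
    (h2 : 2 ≤ (S.filter q).card) : q a ∧ q b := by
  by_contra hnot
  rw [not_and_or] at hnot
  have hsub : ∀ c, ¬ q c → (c = a ∨ c = b) → S.filter q ⊆ ({a, b} : Finset κ).erase c := by
    intro c hc _ x hx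
    rw [mem_filter] at hx
    exact mem_erase.2 ⟨fun h => hc (h ▸ hx.2), hS hx.1⟩
  have hle : ∀ c, ¬ q c → (c = a ∨ c = b) → (S.filter q).card ≤ 1 := by
    intro c hc hcab
    refine (card_le_card (hsub c hc hcab)).trans ?_
    have hcm : c ∈ ({a, b} : Finset κ) := by rcases hcab with rfl | rfl <;> simp
    rw [card_erase_of_mem hcm]
    exact Nat.sub_le_of_le_add ((card_insert_le a {b}).trans (by simp))
  rcases hnot with h | h
  · have := hle a h (Or.inl rfl); omega
  · have := hle b h (Or.inr rfl); omega

/-- **`|P| = 2`: good chains `(a, b, then non-pure members in any order)` from (α).**  Let `a ≠ b` be pure with every pure member among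
`a, b`.  For every list `l` (no repetition) of non-pure members of `W` each satisfying (α), the chain `l ++ [b, a]` (read: `a` first, then `b`,
then `l` from its last element) is good, and its frame support is `esupp (U a) ∪ esupp (U b) ∪ ⋃_{y ∈ l} esupp (gframe y)`. [this work] -/
theorem goodChain_append_pair_of_alpha (hU : ∀ k, IsUpperSet (U k)) (hne : ∀ k, (U k).Nonempty)
    (hd : ∀ x ∈ W, ∀ x' ∈ W, x ≠ x' → Disjoint (esupp (gframe U W x)) (esupp (gframe U W x')))
    {a b : κ} (ha : a ∈ W) (hb : b ∈ W) (hab : a ≠ b) (hpa : gann U W a = ∅) (hpb : gann U W b = ∅)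
    (hP : ∀ p ∈ W, gann U W p = ∅ → p = a ∨ p = b) :
    ∀ (n : ℕ) (l : List κ), l.length ≤ n → l.Nodup → (∀ y ∈ l, y ∈ W ∧ gann U W y ≠ ∅) →
      (∀ y ∈ l, ∀ χ ∈ gann U W y, 2 ≤ ((W.filter fun p => gann U W p = ∅).filter fun p => χ ∉ U p).card) →
      GoodChain U (l ++ [b, a]) ∧
        frameSupp U (l ++ [b, a]) = ↑(esupp (U a)) ∪ ↑(esupp (U b)) ∪ ⋃ y ∈ l.toFinset, (↑(esupp (gframe U W y)) : Set ι) := by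
  have hga : gframe U W a = U a := (gann_eq_empty_iff U W hU a).1 hpa
  have hgb : gframe U W b = U b := (gann_eq_empty_iff U W hU b).1 hpb
  have hdab : Disjoint (esupp (U b)) (esupp (U a)) := by
    have := hd b hb a ha hab.symm; rwa [hga, hgb] at this
  have hPsub : (W.filter fun p => gann U W p = ∅) ⊆ {a, b} := by
    intro p hp; rw [mem_filter] at hp
    rcases hP p hp.1 hp.2 with rfl | rfl <;> simp
  -- the base chain `[b, a]`
  have hbase : GoodChain U [b, a] ∧ frameSupp U [b, a] = ↑(esupp (U a)) ∪ ↑(esupp (U b)) := by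
    refine ⟨(goodChain_pair_iff U hU hab.symm).2 hdab, ?_⟩
    rw [frameSupp_cons, frameIn_cons_self, frameSupp_singleton,
      hull_eq_self_of_disjoint (hU b) (disjoint_coe.2 hdab).symm]
  intro n
  induction n with
  | zero =>
    intro l hl _ _ _
    have : l = [] := List.eq_nil_of_length_eq_zero (Nat.le_zero.1 hl)
    subst this
    simpa using hbase
  | succ n ih =>
    intro l hl hnd hlW hlα
    match l, hl, hnd, hlW, hlα with
    | [], _, _, _, _ => simpa using hbase
    | y :: l', hl, hnd, hlW, hlα =>
      have hl' : l'.length ≤ n := by simp only [List.length_cons] at hl; omega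
      have hnd' : l'.Nodup := (List.nodup_cons.1 hnd).2
      have hyl' : y ∉ l' := (List.nodup_cons.1 hnd).1
      have hlW' : ∀ z ∈ l', z ∈ W ∧ gann U W z ≠ ∅ := fun z hz => hlW z (List.mem_cons_of_mem y hz)
      have hlα' : ∀ z ∈ l', ∀ χ ∈ gann U W z, 2 ≤ ((W.filter fun p => gann U W p = ∅).filter fun p => χ ∉ U p).card :=
        fun z hz => hlα z (List.mem_cons_of_mem y hz)
      obtain ⟨ihc, ihS⟩ := ih l' hl' hnd' hlW' hlα'
      obtain ⟨hyW, hyN⟩ := hlW y List.mem_cons_self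
      have hya : y ≠ a := fun h => hyN (h ▸ hpa)
      have hyb : y ≠ b := fun h => hyN (h ▸ hpb)
      -- the frame support so far misses the glued block of `y` and covers the pure supports
      set T : Set ι := ↑(esupp (U a)) ∪ ↑(esupp (U b)) ∪ ⋃ z ∈ l'.toFinset, (↑(esupp (gframe U W z)) : Set ι) with hTdef
      have hTy : Disjoint T ↑(esupp (gframe U W y)) := by
        rw [hTdef, Set.disjoint_union_left, Set.disjoint_union_left, Set.disjoint_iUnion₂_left]
        refine ⟨⟨?_, ?_⟩, fun z hz => ?_⟩
        · have := hd a ha y hyW hya.symm; rw [hga] at this; exact disjoint_coe.2 this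
        · have := hd b hb y hyW hyb.symm; rw [hgb] at this; exact disjoint_coe.2 this
        · have hzy : z ≠ y := fun h => hyl' (h ▸ List.mem_toFinset.1 hz)
          exact disjoint_coe.2 (hd z (hlW' z (List.mem_toFinset.1 hz)).1 y hyW hzy)
      have hcov : ∀ χ ∈ gann U W y, ∃ p, χ ∉ U p ∧ ↑(esupp (U p)) ⊆ T := by
        intro χ hχ
        obtain ⟨hqa, -⟩ := and_of_two_le_card_filter hPsub (hlα y List.mem_cons_self χ hχ)
        exact ⟨a, hqa, fun x hx => Or.inl (Or.inl hx)⟩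
      have hframe : hull T (U y) = gframe U W y := (gframe_eq_hull_of_cover U W hU hne hTy hcov).symm
      have hfs : frameSupp U (l' ++ [b, a]) = T := ihS
      refine ⟨?_, ?_⟩
      · -- the new member `y` is last: its annihilator is the glued annihilator, safe for the prefix
        show GoodChain U (y :: (l' ++ [b, a]))
        rw [goodChain_cons]
        refine ⟨ihc, ?_, ?_⟩
        · simp only [List.mem_append, List.mem_cons, List.not_mem_nil, or_false, not_or]
          exact ⟨hyl', hyb, hya⟩
        intro φ hφ
        rw [hfs, hframe] at hφ
        obtain ⟨hqa, hqb⟩ := and_of_two_le_card_filter hPsub (hlα y List.mem_cons_self φ hφ)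
        have haL : a ∈ (l' ++ [b, a]).toFinset := by simp
        have hbL : b ∈ (l' ++ [b, a]).toFinset := by simp
        rw [mem_safe]
        refine ⟨?_, fun R hFR hRL => ?_⟩
        · have hsub : ({a, b} : Finset κ) ⊆ failSet U (l' ++ [b, a]).toFinset φ := by
            intro c hc
            rcases mem_insert.1 hc with rfl | hc
            · exact (mem_failSet U).2 ⟨haL, hqa⟩
            · rw [mem_singleton] at hc; subst hc; exact (mem_failSet U).2 ⟨hbL, hqb⟩
          exact (card_pair hab).symm.le.trans (card_le_card hsub)
        · -- `R ⊇ {a, b}`: it is enumerated by the sub-list of `l'` of its members, then `b, a` — good by the induction hypothesis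
          have haR : a ∈ R := hFR ((mem_failSet U).2 ⟨haL, hqa⟩)
          have hbR : b ∈ R := hFR ((mem_failSet U).2 ⟨hbL, hqb⟩)
          set l'' := l'.filter (fun z => z ∈ R) with hl''def
          have hlen : l''.length ≤ n := (List.length_filter_le _ _).trans hl'
          have hnd'' : l''.Nodup := hnd'.filter _
          have hmem'' : ∀ z, z ∈ l'' ↔ z ∈ l' ∧ z ∈ R := fun z => by simp [hl''def]
          obtain ⟨hc'', -⟩ := ih l'' hlen hnd'' (fun z hz => hlW' z ((hmem'' z).1 hz).1) (fun z hz => hlα' z ((hmem'' z).1 hz).1)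
          refine ⟨l'' ++ [b, a], ?_, hc''⟩
          ext z
          simp only [List.toFinset_append, mem_union, List.mem_toFinset, hmem'', List.mem_cons, List.not_mem_nil, or_false]
          constructor
          · rintro (⟨-, hz⟩ | rfl | rfl)
            exacts [hz, hbR, haR]
          · intro hzR
            have hzL := hRL hzR
            simp only [List.toFinset_append, mem_union, List.mem_toFinset, List.mem_cons, List.not_mem_nil, or_false] at hzL
            rcases hzL with hz | rfl | rfl
            · exact Or.inl ⟨hz, hzR⟩
            · exact Or.inr (Or.inl rfl)
            · exact Or.inr (Or.inr rfl)
      · show frameSupp U (y :: (l' ++ [b, a])) = _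
        rw [frameSupp_cons, frameIn_cons_self, hfs, hframe, List.toFinset_cons]
        ext x
        simp only [Set.mem_union, Set.mem_iUnion, mem_insert, exists_prop, hTdef]
        constructor
        · rintro ((h | ⟨z, hz, hx⟩) | h)
          · exact Or.inl h
          · exact Or.inr ⟨z, Or.inr hz, hx⟩
          · exact Or.inr ⟨y, Or.inl rfl, h⟩
        · rintro (h | ⟨z, hz | hz, hx⟩)
          · exact Or.inl (Or.inl h)
          · subst hz; exact Or.inr hx
          · exact Or.inl (Or.inr ⟨z, hz, hx⟩)

/-! ### LG_k from (α) when `|P| = 2` or `|N| = 2` -/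

/-- **The local-to-global step from (α)**: for a family (indexed by a finite type with `≥ 4` members) of non-empty increasing events with
support-disjoint glued frames, if every glued annihilator point fails at least two pure members and either exactly two members are pure or exactly
two are non-pure, then some deletion is structured — contradiction with "no structured deletion". [this work] -/
theorem false_of_alpha [Fintype κ] (hU : ∀ k, IsUpperSet (U k)) (hne : ∀ k, (U k).Nonempty)
    (hd : ∀ x x', x ≠ x' → Disjoint (esupp (gframe U univ x)) (esupp (gframe U univ x')))
    (hdel : ∀ x, ¬ Structured U (univ.erase x)) (h4 : 4 ≤ (univ : Finset κ).card)
    (hα : ∀ y, ∀ χ ∈ gann U univ y, 2 ≤ ((univ.filter fun p => gann U univ p = ∅).filter fun p => χ ∉ U p).card)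
    (hPN : (univ.filter fun p : κ => gann U univ p = ∅).card = 2 ∨ (univ.filter fun p : κ => gann U univ p ≠ ∅).card = 2) : False := by
  have hd' : ∀ x ∈ (univ : Finset κ), ∀ x' ∈ (univ : Finset κ), x ≠ x' →
      Disjoint (esupp (gframe U univ x)) (esupp (gframe U univ x')) := fun x _ x' _ h => hd x x' h
  set P := (univ : Finset κ).filter fun p => gann U univ p = ∅ with hPdef
  set N := (univ : Finset κ).filter fun p => gann U univ p ≠ ∅ with hNdef
  -- at least two non-pure members (else a deletion consists of pure, pairwise independent members)
  have hpure_struct : ∀ R : Finset κ, (∀ x ∈ R, gann U univ x = ∅) → Structured U R := by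
    intro R hR
    refine structured_of_pairwise_disjoint U hU fun x hx x' hx' hxx' => ?_
    have e1 := (gann_eq_empty_iff U univ hU x).1 (hR x hx)
    have e2 := (gann_eq_empty_iff U univ hU x').1 (hR x' hx')
    have := hd x x' hxx'
    rwa [e1, e2] at this
  have hN2 : 2 ≤ N.card := by
    by_contra hlt
    push Not at hlt
    obtain ⟨x, hx⟩ : ∃ x, ∀ y ∈ (univ : Finset κ).erase x, gann U univ y = ∅ := by
      rcases Nat.lt_or_ge N.card 1 with h0 | h1
      · have hN0 : N = ∅ := card_eq_zero.1 (by omega)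
        obtain ⟨x, -⟩ : (univ : Finset κ).Nonempty := card_pos.1 (by omega)
        refine ⟨x, fun y _ => ?_⟩
        by_contra hy'
        have : y ∈ N := mem_filter.2 ⟨mem_univ y, hy'⟩
        rw [hN0] at this; exact notMem_empty y this
      · obtain ⟨x, hx⟩ := card_pos.1 (by omega : 0 < N.card)
        refine ⟨x, fun y hy => ?_⟩
        by_contra hy'
        have hyN : y ∈ N := mem_filter.2 ⟨mem_univ y, hy'⟩
        have : ({x, y} : Finset κ) ⊆ N := by
          intro z hz; simp only [mem_insert, mem_singleton] at hz; rcases hz with rfl | rfl <;> assumption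
        have hc := card_le_card this
        rw [card_pair (ne_of_mem_erase hy).symm] at hc
        omega
    exact hdel x (hpure_struct _ hx)
  rcases hPN with hP2 | hN2'
  · -- `|P| = 2`: `P = {a, b}`; delete any non-pure `w`; the rest is a good chain `(a, b, N ∖ w)`
    obtain ⟨a, b, hab, hPab⟩ := card_eq_two.1 hP2
    have ha : a ∈ P := by rw [hPab]; simp
    have hb : b ∈ P := by rw [hPab]; simp
    rw [hPdef, mem_filter] at ha hb
    obtain ⟨w, hw⟩ : N.Nonempty := card_pos.1 (by omega)
    set l := (N.erase w).toList with hldef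
    have hlmem : ∀ y, y ∈ l ↔ y ≠ w ∧ gann U univ y ≠ ∅ := fun y => by
      rw [hldef, mem_toList, mem_erase, hNdef, mem_filter]; simp
    obtain ⟨hchain, -⟩ := goodChain_append_pair_of_alpha U univ hU hne hd' (mem_univ a) (mem_univ b) hab ha.2 hb.2
      (fun p _ hp => by
        have : p ∈ P := mem_filter.2 ⟨mem_univ p, hp⟩
        rw [hPab] at this; simpa using this)
      l.length l le_rfl (nodup_toList _) (fun y hy => ⟨mem_univ y, ((hlmem y).1 hy).2⟩) (fun y _ => hα y)
    apply hdel w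
    refine ⟨l ++ [b, a], ?_, hchain⟩
    have hwN := (mem_filter.1 hw).2
    ext z
    simp only [List.toFinset_append, mem_union, List.mem_toFinset, hlmem, List.mem_cons, List.not_mem_nil, or_false, mem_erase,
      mem_univ, and_true]
    constructor
    · rintro (⟨hz, -⟩ | rfl | rfl)
      · exact hz
      · exact fun h => hwN (h ▸ hb.2)
      · exact fun h => hwN (h ▸ ha.2)
    · intro hzw
      by_cases hz : gann U univ z = ∅
      · have : z ∈ P := mem_filter.2 ⟨mem_univ z, hz⟩
        rw [hPab] at this
        simp only [mem_insert, mem_singleton] at this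
        rcases this with rfl | rfl
        · exact Or.inr (Or.inr rfl)
        · exact Or.inr (Or.inl rfl)
      · exact Or.inl ⟨hzw, hz⟩
  · -- `|N| = 2`: `N = {v, w}`; the deletion of `w` is `P + v`, structured by (α) at `v`
    obtain ⟨v, w, hvw, hNvw⟩ := card_eq_two.1 hN2'
    have hv : v ∈ N := by rw [hNvw]; simp
    rw [hNdef, mem_filter] at hv
    have hst := structured_insert_pures_of_alpha U univ hU hd' (mem_univ v) hv.2 (hα v)
    apply hdel w
    convert hst using 1
    ext z
    simp only [mem_erase, mem_univ, and_true, mem_insert, mem_filter, true_and]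
    constructor
    · intro hzw
      by_cases hz : gann U univ z = ∅
      · exact Or.inr hz
      · have : z ∈ N := mem_filter.2 ⟨mem_univ z, hz⟩
        rw [hNvw] at this
        simp only [mem_insert, mem_singleton] at this
        rcases this with rfl | rfl
        · exact Or.inl rfl
        · exact absurd rfl hzw
    · rintro (rfl | hz)
      · exact hvw
      · intro hzw
        have : w ∈ N := by rw [hNvw]; simp
        rw [hNdef, mem_filter] at this
        exact this.2 (hzw ▸ hz)

/-! ### Order five -/

/-- **(α) at order `n + 4`** (OUR CONJECTURE for `n ≥ 1`; a theorem of the structure theory for STRUCTURED families, `two_le_card_pureFail`):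
under the hypotheses of `LocalToGlobal n` (without "no structured deletion"), every configuration of the glued annihilator of a member lies outside at
least two PURE members (members with empty glued annihilator). [this work] [status: open for n ≥ 1; census-exact on {0,1}^4 for n ≤ 1] -/
def AlphaGlued (n : ℕ) : Prop :=
  ∀ (ι : Type) [Fintype ι] (U : Fin (n + 4) → Set (Set ι)), (∀ k, IsUpperSet (U k)) → (∀ k, (U k).Nonempty) →
    (∀ k, U k ≠ Set.univ) → (∀ h, Structured (faceT U h) univ) →
    (∀ x x', x ≠ x' → Disjoint (esupp (gframe U univ x)) (esupp (gframe U univ x'))) →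
    (∀ f, CoreFree U f → Structured (faceF U f) univ) → (∃ f, CoreFree U f) → (∀ f : ι, ∃ h, h ≠ f) →
    (∀ l, ∃ m, m ≠ l ∧ ¬ U m ⊆ U l) →
      ∀ y, ∀ χ ∈ gann U univ y, 2 ≤ ((univ.filter fun p => gann U univ p = ∅).filter fun p => χ ∉ U p).card

/-- **LG_5 from (α) at order five**: with five members, `|P| ≥ 2` (`two_le_card_pure`) and `|N| ≥ 2` force `|P| = 2` or `|N| = 2`. [this work] -/
theorem localToGlobal_one_of_alphaGlued (hA : AlphaGlued 1) : LocalToGlobal 1 := by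
  intro ι _ U hU hne hns hS hd hF hE0 hι habs hdel
  have hd' : ∀ x ∈ (univ : Finset (Fin (1 + 4))), ∀ x' ∈ (univ : Finset (Fin (1 + 4))), x ≠ x' →
      Disjoint (esupp (gframe U univ x)) (esupp (gframe U univ x')) := fun x _ x' _ h => hd x x' h
  have hα := hA ι U hU hne hns hS hd hF hE0 hι habs
  -- `|P| ≥ 2`
  have hFc : ∀ f, CoreFree U f → Structured (faceF U f) univ ∧ FaceFConsistent U univ f := fun f hf =>
    ⟨hF f hf, faceFConsistent_of_noAbsorber U univ hU hne hns hS hd'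
      (fun l _ => by obtain ⟨m, hm, h⟩ := habs l; exact ⟨m, mem_univ m, hm, h⟩) (by simp) hf (hF f hf)⟩
  have hP2 : 2 ≤ ((univ : Finset (Fin (1 + 4))).filter fun w => gann U univ w = ∅).card :=
    two_le_card_pure U univ hU hne (fun k => mem_univ k) hS hd' hFc hE0 (by simp) hι
  have hPN : ((univ : Finset (Fin (1 + 4))).filter fun p => gann U univ p = ∅).card +
      ((univ : Finset (Fin (1 + 4))).filter fun p => gann U univ p ≠ ∅).card = 5 := by
    rw [Finset.card_filter_add_card_filter_not (s := univ) (fun p => gann U univ p = ∅)]; simp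
  refine false_of_alpha U hU hne hd (fun x hs => hdel x (by convert hs using 2)) (by simp) hα ?_
  -- if neither `|P| = 2` nor `|N| = 2` then `|N| ≤ 1` and a deletion consisting of pure members only is structured
  by_contra hnot
  rw [not_or] at hnot
  have hN1 : ((univ : Finset (Fin (1 + 4))).filter fun p => gann U univ p ≠ ∅).card ≤ 1 := by omega
  obtain ⟨x, hx⟩ : ∃ x, ∀ y ∈ (univ : Finset (Fin (1 + 4))).erase x, gann U univ y = ∅ := by
    set N := (univ : Finset (Fin (1 + 4))).filter fun p => gann U univ p ≠ ∅
    rcases Nat.lt_or_ge N.card 1 with h0 | h1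
    · refine ⟨0, fun y _ => ?_⟩
      by_contra hy'
      have : y ∈ N := mem_filter.2 ⟨mem_univ y, hy'⟩
      have hN0 : N = ∅ := card_eq_zero.1 (by omega)
      rw [hN0] at this; exact notMem_empty y this
    · obtain ⟨x, hxN⟩ := card_pos.1 (by omega : 0 < N.card)
      refine ⟨x, fun y hy => ?_⟩
      by_contra hy'
      have hyN : y ∈ N := mem_filter.2 ⟨mem_univ y, hy'⟩
      have : ({x, y} : Finset (Fin (1 + 4))) ⊆ N := by
        intro z hz; simp only [mem_insert, mem_singleton] at hz; rcases hz with rfl | rfl <;> assumption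
      have hc := card_le_card this
      rw [card_pair (ne_of_mem_erase hy).symm] at hc
      omega
  refine hdel x (structured_of_pairwise_disjoint U hU fun y hy y' hy' hyy' => ?_)
  have e1 := (gann_eq_empty_iff U univ hU y).1 (hx y hy)
  have e2 := (gann_eq_empty_iff U univ hU y').1 (hx y' hy')
  have := hd y y' hyy'
  rwa [e1, e2] at this

/-- **THE IDENTICALLY-ZERO MASTER CONJECTURE AT ORDER FIVE, REDUCED TO (α) AT ORDER FIVE**:
`AlphaGlued 1 → MasterFamilyIdentEqIff 5`. [this work] -/
theorem masterFamilyIdentEqIff_five_of_alphaGlued (hA : AlphaGlued 1) : MasterFamilyIdentEqIff 5 :=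
  masterFamilyIdentEqIff_five_of_localToGlobal_one (localToGlobal_one_of_alphaGlued hA)

end GluedFrames

end Summit.CriticalPhenomena.PercolationContinuityZ3.Theorems
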